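import Summits.HubbardSuperconductivity.HubbardLadder.NeelDiagonalCorrelationUniform
import Literature.Probability.LatticeModels.LipschitzRiemannSum
import HarnessLib

/-! # D35 complement — the small tori `L = 4, 6`: the diagonal Néel-sign floor on EVERY even torus

HONEST FRAMING: ladder R1–R4 with certified numbers; no claim on H/H₀.

`NeelDiagonalCorrelationUniform` proves `c_L(1,1) = Re ω(Sᶻ_0 Sᶻ_(1,1)) ≥ 63/5000` for every even
`L ≥ 8` (S = ½ Heisenberg antiferromagnet on the `L × L` torus, tracial ground state) by bounding the
punctured Riemann sum `𝓦(L) = klsDiagRiemannSum 1 (5/8) (-21/64) L` with a polynomial majorant `M`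
whose lattice average is exactly its constant Fourier coefficient once `L ≥ 7`.  For `L = 4, 6` that
orthogonality is not available, but the lattice average of the SAME majorant is an explicit rational
(the grid cosines are `0, ±1, ±1/2`): `L⁻² Σ_q M = 39273347/67108864 ≈ 0.58522` (`L = 4`) and
`316803545/536870912 ≈ 0.59009` (`L = 6`).
With `heisRedCorr2_diag_lower_energyFree` this gives `c_4(1,1) ≥ 0.0135` and `c_6(1,1) ≥ 0.0123`,
hence the clean statement **`c_L(1,1) ≥ 3/250 = 0.012` for EVERY even `L ≥ 4`**
(`heisRedCorr2_diag_lower_allEven`).  No energy input, no Marshall sign rule, no reflection-positivity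
cut; kernel arithmetic only (`norm_num` on the 16 + 36 grid values of `M`).
-/

noncomputable section

open Finset Literature.MathematicalPhysics.QuantumLattice Literature.Probability.LatticeModels

namespace Summit.HubbardSuperconductivity.HubbardLadder

/-! ### Grid cosines -/

/-- Auxiliary lemma `kls_cos_grid4_1` (support step for the results of this file; see the module docstring). -/
private theorem kls_cos_grid4_1 : Real.cos (1 * (2 * Real.pi / 4)) = 0 := by
  rw [show (1 : ℝ) * (2 * Real.pi / 4) = Real.pi / 2 by ring]; exact Real.cos_pi_div_two

/-- Auxiliary lemma `kls_cos_grid4_2` (support step for the results of this file; see the module docstring). -/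
private theorem kls_cos_grid4_2 : Real.cos (2 * (2 * Real.pi / 4)) = -1 := by
  rw [show (2 : ℝ) * (2 * Real.pi / 4) = Real.pi by ring]; exact Real.cos_pi

/-- Auxiliary lemma `kls_cos_grid4_3` (support step for the results of this file; see the module docstring). -/
private theorem kls_cos_grid4_3 : Real.cos (3 * (2 * Real.pi / 4)) = 0 := by
  rw [show (3 : ℝ) * (2 * Real.pi / 4) = Real.pi / 2 + Real.pi by ring, Real.cos_add_pi,
    Real.cos_pi_div_two, neg_zero]

/-- Auxiliary lemma `kls_cos_grid6_1` (support step for the results of this file; see the module docstring). -/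
private theorem kls_cos_grid6_1 : Real.cos (1 * (2 * Real.pi / 6)) = 1 / 2 := by
  rw [show (1 : ℝ) * (2 * Real.pi / 6) = Real.pi / 3 by ring]; exact Real.cos_pi_div_three

/-- Auxiliary lemma `kls_cos_grid6_2` (support step for the results of this file; see the module docstring). -/
private theorem kls_cos_grid6_2 : Real.cos (2 * (2 * Real.pi / 6)) = -(1 / 2) := by
  rw [show (2 : ℝ) * (2 * Real.pi / 6) = Real.pi - Real.pi / 3 by ring, Real.cos_pi_sub,
    Real.cos_pi_div_three]

/-- Auxiliary lemma `kls_cos_grid6_3` (support step for the results of this file; see the module docstring). -/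
private theorem kls_cos_grid6_3 : Real.cos (3 * (2 * Real.pi / 6)) = -1 := by
  rw [show (3 : ℝ) * (2 * Real.pi / 6) = Real.pi by ring]; exact Real.cos_pi

/-- Auxiliary lemma `kls_cos_grid6_4` (support step for the results of this file; see the module docstring). -/
private theorem kls_cos_grid6_4 : Real.cos (4 * (2 * Real.pi / 6)) = -(1 / 2) := by
  rw [show (4 : ℝ) * (2 * Real.pi / 6) = Real.pi / 3 + Real.pi by ring, Real.cos_add_pi,
    Real.cos_pi_div_three]

/-- Auxiliary lemma `kls_cos_grid6_5` (support step for the results of this file; see the module docstring). -/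
private theorem kls_cos_grid6_5 : Real.cos (5 * (2 * Real.pi / 6)) = 1 / 2 := by
  rw [show (5 : ℝ) * (2 * Real.pi / 6) = -(Real.pi / 3) + 2 * Real.pi by ring, Real.cos_add_two_pi,
    Real.cos_neg, Real.cos_pi_div_three]

/-! ### The lattice averages of the majorant on the `4 × 4` and `6 × 6` dual tori -/

/-- `Σ_{q ∈ T*_4} M(cos q₀, cos q₁) = 39273347/4194304` (exact). [folklore] -/
theorem sum_klsM_four :
    ∑ q : TorusSite 2 4, klsM (Real.cos (latticeMomentum 4 q 0)) (Real.cos (latticeMomentum 4 q 1)) =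
      39273347 / 4194304 := by
  have h := sum_torusSite_two_eq_sum_range (fun x y => klsM (Real.cos x) (Real.cos y)) 4
  beta_reduce at h
  rw [h]
  simp only [sum_range_succ, sum_range_zero, Nat.cast_zero, Nat.cast_one, Nat.cast_ofNat, zero_mul,
    Real.cos_zero, zero_add, kls_cos_grid4_1, kls_cos_grid4_2, kls_cos_grid4_3]
  norm_num [klsM, klsR1, klsR2]

/-- `Σ_{q ∈ T*_6} M(cos q₀, cos q₁) = 2851231905/134217728 = 36 · (316803545/536870912)` (exact).
[folklore] -/
theorem sum_klsM_six :
    ∑ q : TorusSite 2 6, klsM (Real.cos (latticeMomentum 6 q 0)) (Real.cos (latticeMomentum 6 q 1)) =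
      2851231905 / 134217728 := by
  have h := sum_torusSite_two_eq_sum_range (fun x y => klsM (Real.cos x) (Real.cos y)) 6
  beta_reduce at h
  rw [h]
  simp only [sum_range_succ, sum_range_zero, Nat.cast_zero, Nat.cast_one, Nat.cast_ofNat, zero_mul,
    Real.cos_zero, zero_add, kls_cos_grid6_1, kls_cos_grid6_2, kls_cos_grid6_3, kls_cos_grid6_4,
    kls_cos_grid6_5]
  norm_num [klsM, klsR1, klsR2]

/-! ### `𝓦(4)`, `𝓦(6)` and the correlation floors -/

/-- The punctured Riemann sum of an even torus `L = 2k ≥ 2` is dominated by the full lattice sum of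
the majorant `M`, divided by `L²`. [cite: KLS1988JSP, eqs. (4), (6)-(9)] -/
theorem klsDiagRiemannSum_le_sum_klsM (k : ℕ) (hk : 1 ≤ k) [NeZero (2 * k)] :
    klsDiagRiemannSum 1 (5 / 8) (-(21 / 64)) (2 * k) ≤
      (∑ q : TorusSite 2 (2 * k),
          klsM (Real.cos (latticeMomentum (2 * k) q 0)) (Real.cos (latticeMomentum (2 * k) q 1))) /
        (((2 * k : ℕ) : ℝ)) ^ 2 := by
  have hL : (0 : ℝ) < (((2 * k : ℕ) : ℝ)) ^ 2 := by
    have : (0 : ℝ) < ((2 * k : ℕ) : ℝ) := by exact_mod_cast (show 0 < 2 * k by omega)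
    positivity
  rw [klsDiagRiemannSum_of_neZero, div_le_div_iff_of_pos_right hL]
  calc ∑ q ∈ (univ : Finset (TorusSite 2 (2 * k))).erase (neelIndex (2 * k)),
        max (-klsDiagKernel 1 (5 / 8) (-(21 / 64)) (2 * k) q) 0 *
          Real.sqrt (dispersion (latticeMomentum (2 * k) q) /
            dispersion (latticeMomentum (2 * k) (q - neelIndex (2 * k))))
      ≤ ∑ q ∈ (univ : Finset (TorusSite 2 (2 * k))).erase (neelIndex (2 * k)),
          klsM (Real.cos (latticeMomentum (2 * k) q 0)) (Real.cos (latticeMomentum (2 * k) q 1)) :=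
        sum_le_sum fun q hq => klsDiag_summand_le k hk q (ne_of_mem_erase hq)
    _ ≤ ∑ q : TorusSite 2 (2 * k),
          klsM (Real.cos (latticeMomentum (2 * k) q 0)) (Real.cos (latticeMomentum (2 * k) q 1)) :=
        sum_le_sum_of_subset_of_nonneg (erase_subset _ _) fun q _ _ =>
          klsM_nonneg (by linarith [Real.neg_one_le_cos (latticeMomentum (2 * k) q 0),
            Real.neg_one_le_cos (latticeMomentum (2 * k) q 1)])
            (by linarith [Real.cos_le_one (latticeMomentum (2 * k) q 0),
              Real.cos_le_one (latticeMomentum (2 * k) q 1)])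

/-- **`𝓦(4) ≤ 39273347/67108864 ≈ 0.58522`.** [cite: KLS1988JSP, eqs. (4), (6)-(9)] -/
theorem klsDiagRiemannSum_four_le :
    klsDiagRiemannSum 1 (5 / 8) (-(21 / 64)) (2 * 2) ≤ 39273347 / 67108864 := by
  have h := klsDiagRiemannSum_le_sum_klsM 2 (by norm_num)
  have hs : (∑ q : TorusSite 2 (2 * 2),
      klsM (Real.cos (latticeMomentum (2 * 2) q 0)) (Real.cos (latticeMomentum (2 * 2) q 1))) =
        39273347 / 4194304 := sum_klsM_four
  rw [hs] at h
  norm_num at h ⊢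
  linarith

/-- **`𝓦(6) ≤ 316803545/536870912 ≈ 0.59009`.** [cite: KLS1988JSP, eqs. (4), (6)-(9)] -/
theorem klsDiagRiemannSum_six_le :
    klsDiagRiemannSum 1 (5 / 8) (-(21 / 64)) (2 * 3) ≤ 316803545 / 536870912 := by
  have h := klsDiagRiemannSum_le_sum_klsM 3 (by norm_num)
  have hs : (∑ q : TorusSite 2 (2 * 3),
      klsM (Real.cos (latticeMomentum (2 * 3) q 0)) (Real.cos (latticeMomentum (2 * 3) q 1))) =
        2851231905 / 134217728 := sum_klsM_six
  rw [hs] at h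
  norm_num at h ⊢
  linarith

/-- **`c_4(1,1) ≥ 27/2000 = 0.0135`** on the `4 × 4` torus (exact bound `21/256 - 𝓦̄₄²/5 ≈ 0.013535`),
energy-free, sign-rule-free. HONEST FRAMING: ladder R1–R4 with certified numbers; no claim on H/H₀.
[cite: KLS1988JSP, eqs. (1)-(3), (6)-(9), p. 1023] [cite: DLS1978, Theorem 4.2] -/
theorem heisRedCorr2_diag_lower_four : (27 : ℝ) / 2000 ≤ heisRedCorr2 4 1 1 1 := by
  have h := heisRedCorr2_diag_lower_energyFree 2 (by norm_num) (b := 5 / 8) (t := -(21 / 64))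
    (by norm_num) (by norm_num)
  have hW := klsDiagRiemannSum_four_le
  have hW0 := klsDiagRiemannSum_nonneg 1 (5 / 8) (-(21 / 64)) (2 * 2)
  have h4 : heisRedCorr2 (2 * 2) 1 1 1 = heisRedCorr2 4 1 1 1 := rfl
  rw [h4] at h
  nlinarith [mul_le_mul hW hW hW0 (by norm_num)]

/-- **`c_6(1,1) ≥ 123/10000 = 0.0123`** on the `6 × 6` torus (exact bound `21/256 - 𝓦̄₆²/5 ≈ 0.012389`),
energy-free, sign-rule-free. HONEST FRAMING: ladder R1–R4 with certified numbers; no claim on H/H₀.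
[cite: KLS1988JSP, eqs. (1)-(3), (6)-(9), p. 1023] [cite: DLS1978, Theorem 4.2] -/
theorem heisRedCorr2_diag_lower_six : (123 : ℝ) / 10000 ≤ heisRedCorr2 6 1 1 1 := by
  have h := heisRedCorr2_diag_lower_energyFree 3 (by norm_num) (b := 5 / 8) (t := -(21 / 64))
    (by norm_num) (by norm_num)
  have hW := klsDiagRiemannSum_six_le
  have hW0 := klsDiagRiemannSum_nonneg 1 (5 / 8) (-(21 / 64)) (2 * 3)
  have h6 : heisRedCorr2 (2 * 3) 1 1 1 = heisRedCorr2 6 1 1 1 := rfl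
  rw [h6] at h
  nlinarith [mul_le_mul hW hW hW0 (by norm_num)]

/-- **Device D35, all even tori: `c_L(1,1) = Re ω(Sᶻ_0 Sᶻ_(1,1)) ≥ 3/250 = 0.012` for EVERY even
`L ≥ 4`** (S = ½ Heisenberg antiferromagnet on the `L × L` torus, tracial ground state; `L = 4, 6` from
the explicit lattice averages above, `L ≥ 8` from `heisRedCorr2_diag_lower_uniform'` with the better
constant `63/5000`). HONEST FRAMING: ladder R1–R4 with certified numbers; no claim on H/H₀.
[cite: KLS1988JSP, eqs. (1)-(3), (6)-(9), p. 1023] [cite: DLS1978, Theorem 4.2] -/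
theorem heisRedCorr2_diag_lower_allEven (L : ℕ) (hL : 4 ≤ L) (hev : Even L) :
    (3 : ℝ) / 250 ≤ heisRedCorr2 L 1 1 1 := by
  rcases Nat.lt_or_ge L 8 with h8 | h8
  · obtain ⟨k, rfl⟩ := hev
    have hk : k = 2 ∨ k = 3 := by omega
    rcases hk with rfl | rfl
    · exact le_trans (by norm_num) heisRedCorr2_diag_lower_four
    · exact le_trans (by norm_num) heisRedCorr2_diag_lower_six
  · exact le_trans (by norm_num) (heisRedCorr2_diag_lower_uniform' L h8 hev)

end Summit.HubbardSuperconductivity.HubbardLadder
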